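import Summits.FinalStateConjecture.FinalStateConjecture.Theorems.PhotonSphereChannelsChannelsResolveTameDevelopmentsRLocalEnergyDecay
import Summits.FinalStateConjecture.FinalStateConjecture.Theorems.PhotonSphereChannelsChannelsResolveTameDevelopmentsRCompactExhaustion
import Summits.FinalStateConjecture.FinalStateConjecture.Theorems.PhotonSphereChannelsChannelsResolveTameDevelopmentsRExhaustionDensity
import Summits.FinalStateConjecture.FinalStateConjecture.Theorems.PhotonSphereChannelsChannelsResolveTameDevelopmentsRSilenceReduction

/-!
# Route PhotonSphereChannels · crux `ChannelsResolveTameDevelopmentsR` (stmt-FinalStateConjecture-14075) ·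
# line `isolated-kerr-connected-hull`: the registered stub `stub_outgoingEnergyExhaustion` (H4)

**Outgoing energy exhaustion for the Regge–Wheeler family on Schwarzschild** (asymptotic completeness in
energy form, fixed mode): for every `M > 0`, tortoise radius function `r` (`IsTortoiseRadius M r xc`),
spin `s ≤ 2`, angular number `ℓ ≥ s` and every finite-energy global `C²` solution `ψ` of
`ψ_tt − ψ_xx + V_{s,ℓ}(r(x)) ψ = 0`, the forward channel energy of the time-shifted solution
`ψ(T + ·)` through the bare light cone about `xc` — the energy radiated through `𝓘⁺ ∪ 𝓗⁺` after the
cone of centre `T` — tends to the TOTAL energy as `T → +∞`: no energy lags behind every light cone or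
hovers near the potential.

This file only assembles the three landed sub-goals of the lead's decomposition (wave 2 of the line):

* `stub_rwLocalEnergyDecay` (`…RLocalEnergyDecay`, p93813): integrated local energy decay on compact
  tortoise intervals for compactly supported data — a Morawetz multiplier vanishing at the photon
  sphere `r = 3M`, positivity by an explicit sum-of-squares in `ℓ(ℓ+1)` (`…RMorawetzWeight`), the
  multiplier identity on rectangles (`…RMorawetzIdentity`) and slice/absorption tools (`…RLocalEnergyTools`);
* `stub_compactExhaustionOfLocalDecay` (`…RCompactExhaustion`, p92613): local decay ⇒ exhaustion for
  compactly supported data — `|x − xc|`-weighted transport identities for `ψ_t ± ψ_x`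
  (`…RWeightedTransport`, `…RWeightedEstimate`), repulsivity of the potential at both ends
  (`…RPotentialRepulsion`), quadrant bounds and the cone-interior flux identity (`…RExhaustion`);
* `stub_exhaustionDensity` (`…RExhaustionDensity`, p91212): compact-data exhaustion ⇒ exhaustion for all
  finite-energy solutions — energy-small compactly supported approximation (`…RCutoffCalculus`,
  `…REnergyTails`) and stability of exhaustion under energy-small decompositions
  (`…RExhaustionStability`).

With H4, stub L of the line (`FutureSilentWavesVanish`: a finite-energy RW solution silent through the
forward light cone at every centre vanishes identically) follows by `RW.futureSilentWavesVanish_of_exhaustion`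
(`…RSilenceReduction`, p88349); the corollary is recorded below (`RW.futureSilentWavesVanish`).

Sources: Dimock–Kay, Ann. Phys. 175 (1987) 366 (scattering for the Schwarzschild wave equation);
Dafermos–Rodnianski, arXiv:0811.0354, §4 (Morawetz/X estimate at the photon sphere) and arXiv:0910.4957
(the `r^p` weights); Bachelot–Motet-Bachelot, Ann. IHP Phys. Théor. 59 (1993) 3 (Regge–Wheeler
scattering). No named fact is used: the closure is unconditional.
-/

noncomputable section

-- every `Summit.FinalStateConjecture.FinalStateConjecture.…` name repeats the summit = sub-problem
-- segment (D-0017 layout), as in every landed `…Theorems` file of this route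
set_option linter.dupNamespace false

open Set Filter Topology MeasureTheory
open scoped ENNReal

namespace Summit.FinalStateConjecture.FinalStateConjecture.Theorems

open Literature.Geometry.Lorentzian Literature.Geometry.Lorentzian.ReggeWheeler

/-- **Registered stub `stub_outgoingEnergyExhaustion` (H4) of crux stmt-FinalStateConjecture-14075, line
`isolated-kerr-connected-hull`: outgoing energy exhaustion for the Regge–Wheeler family.** For every
finite-energy global `C²` Regge–Wheeler solution `ψ` (`s ≤ 2`, `ℓ ≥ s`) on the Schwarzschild tortoise line,
`channelEnergy V xc 0 (ψ(T + ·)) atTop → totalEnergy V ψ 0` as `T → +∞`. Assembly of the three landed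
sub-goals: density ∘ (compact-data exhaustion from integrated local energy decay) ∘ ILED.
Proved here unconditionally (no named fact); the statement is the energy form of
asymptotic completeness for the Schwarzschild wave/Regge–Wheeler equations, cf. Dimock–Kay, Ann. Phys. 175
(1987) 366 (bib key DimockKay1987) and Dafermos–Rodnianski arXiv:0811.0354 (bib key DafermosRodnianski2008).
[folklore] -/
theorem stub_outgoingEnergyExhaustion :
    ∀ M : ℝ, 0 < M → ∀ (r : ℝ → ℝ) (xc : ℝ), ReggeWheeler.IsTortoiseRadius M r xc →
      ∀ (s ℓ : ℕ), s ≤ 2 → s ≤ ℓ → ∀ ψ : ℝ → ℝ → ℝ, ReggeWheeler.IsRWSolution M s ℓ r ψ →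
        ReggeWheeler.totalEnergy (ReggeWheeler.linePotential M s ℓ r) ψ 0 < ⊤ →
        Tendsto (fun T ↦ ReggeWheeler.channelEnergy (ReggeWheeler.linePotential M s ℓ r) xc 0
          (fun t x ↦ ψ (T + t) x) atTop) atTop
          (𝓝 (ReggeWheeler.totalEnergy (ReggeWheeler.linePotential M s ℓ r) ψ 0)) :=
  stub_exhaustionDensity (stub_compactExhaustionOfLocalDecay stub_rwLocalEnergyDecay)

namespace RW

/-- **Outgoing energy exhaustion** (H4), curried form over `IsTortoiseRadius`/`IsRWSolution`: the forward
channel energy of `ψ(T + ·)` through the bare cone about `xc` tends to the total energy (proved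
here; cf. Dimock–Kay 1987, bib key DimockKay1987). [folklore] -/
theorem outgoingEnergyExhaustion {M : ℝ} {r : ℝ → ℝ} {xc : ℝ} (hr : IsTortoiseRadius M r xc)
    {s ℓ : ℕ} (hs : s ≤ 2) (hsℓ : s ≤ ℓ) {ψ : ℝ → ℝ → ℝ} (hψ : IsRWSolution M s ℓ r ψ)
    (hE : totalEnergy (linePotential M s ℓ r) ψ 0 < ⊤) :
    Tendsto (fun T ↦ channelEnergy (linePotential M s ℓ r) xc 0 (fun t x ↦ ψ (T + t) x) atTop) atTop
      (𝓝 (totalEnergy (linePotential M s ℓ r) ψ 0)) :=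
  stub_outgoingEnergyExhaustion M hr.mass_pos r xc hr s ℓ hs hsℓ ψ hψ hE

/-- **Linear silent rigidity on Schwarzschild** (stub L of the line, now unconditional): a finite-energy
global `C²` Regge–Wheeler solution (`s ≤ 2`, `ℓ ≥ s`) which, for EVERY centre `T`, has zero forward channel
energy through the bare light cone about `xc` vanishes identically. H1 + H4 via
`RW.futureSilentWavesVanish_of_exhaustion` (p88349); proved here unconditionally. [folklore] -/
theorem futureSilentWavesVanish {M : ℝ} {r : ℝ → ℝ} {xc : ℝ} (hr : IsTortoiseRadius M r xc)
    {s ℓ : ℕ} (hs : s ≤ 2) (hsℓ : s ≤ ℓ) {ψ : ℝ → ℝ → ℝ} (hψ : IsRWSolution M s ℓ r ψ)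
    (hE : totalEnergy (linePotential M s ℓ r) ψ 0 < ⊤)
    (hsil : ∀ T : ℝ, channelEnergy (linePotential M s ℓ r) xc 0 (fun t x ↦ ψ (T + t) x) atTop = 0)
    (t x : ℝ) : ψ t x = 0 :=
  futureSilentWavesVanish_of_exhaustion hr hsℓ hψ (outgoingEnergyExhaustion hr hs hsℓ hψ hE) hsil t x

end RW

end Summit.FinalStateConjecture.FinalStateConjecture.Theorems

end
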